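import Summits.Schanuel.Schanuel.Theorems.RootDecomp1KTorsionCells
import Literature.NumberTheory.Transcendental.ExpLogSimultaneousApproximationMeasure

/-!
# RootDecomp1KKummerDegree — §22 REV D «KummerCells» port, part 1/4 (lens 6, gen 10 = ROUND 5 theorem round of route-Schanuel-RootDecomp1K on A₄ʰ stmt-Schanuel-33363)

Mechanical port (census-1 gen 8; tools tools/build_dark.py over census/tools/gen7/portkit2.py) of §22 of HOME/decomp-schanuel-lens-6/g10/addendum/KummerCells.lean
(sha256 228dad56…, 9085 l; critic VERDICT 2026-08-30T17:19:03Z ACCEPTED — THEOREM ROUND, PATH T, census C-7) on top of the §17 wave Theorems/RootDecomp1KHyper01…19.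
This part: node lines 8137–8405 (10 declarations: norm_multiset_prod_eq_pow, kummer_aeval_ne_zero, kphi, kphi_nonneg, kphi_mono, two_e_log_two_le_four …).
The node-local named fact `NWThm1` is replaced by the registered Literature fact
`Literature.NumberTheory.Transcendental.NesterenkoWaldschmidt1996_thm_1` (token-identical body); statements and proofs
are otherwise the node's verbatim, in the wave namespace `Summit.Schanuel.Schanuel.Theorems.RootDecomp1KHyper` (sub-namespace `HyperCell`).
`--supports stmt-Schanuel-33363` (A₄ʰ HyperLiouvilleSchanuel: decided n = 2, 3 cells at every Kummer anchor s·log 2, s ∈ ℚ^× (ρ hyper-Liouville), mod the registered fact NW96 Thm 1 alone). Sorry-free; standard axioms. Nothing here proves Schanuel; rung 0.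
-/

set_option linter.dupNamespace false
set_option linter.unusedSectionVars false

noncomputable section

open Complex IntermediateField Filter Polynomial
open Literature.NumberTheory.Transcendental (NesterenkoWaldschmidt1996_thm_1)

namespace Summit.Schanuel.Schanuel.Theorems.RootDecomp1KHyper

variable {n K : ℕ}

namespace HyperCell

variable {n K : ℕ}

/-- node: auxiliary statement `one_le_mahlerMeasure_map_of_ne_zero` (lens 6 gen 10 node, ported verbatim). -/
private theorem one_le_mahlerMeasure_map_of_ne_zero {R : ℤ[X]} (hR : R ≠ 0) :
    1 ≤ (R.map (Int.castRingHom ℂ)).mahlerMeasure := by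
  refine one_le_mahlerMeasure_of_one_le_norm_leadingCoeff ?_
  rw [Polynomial.leadingCoeff_map_of_injective (RingHom.injective_int _), eq_intCast,
    Complex.norm_intCast]
  exact_mod_cast Int.one_le_abs (Polynomial.leadingCoeff_ne_zero.mpr hR)

/-- norms of a multiset all equal to `γ` ⇒ norm of the product is `γ ^ card` -/
theorem norm_multiset_prod_eq_pow {γ : ℝ} :
    ∀ s : Multiset ℂ, (∀ x ∈ s, ‖x‖ = γ) → ‖s.prod‖ = γ ^ Multiset.card s := by
  intro s
  induction s using Multiset.induction_on with
  | empty => intro _; simp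
  | cons a s ih =>
    intro h
    rw [Multiset.prod_cons, norm_mul, Multiset.card_cons, pow_succ, mul_comm (γ ^ _),
      h a (Multiset.mem_cons_self a s), ih fun x hx => h x (Multiset.mem_cons_of_mem hx)]

/-- **Kummer degree lemma.** If `b ^ q = a ^ p` in `ℂ` with `a` prime and `gcd(p, q) = 1`,
then `b` has degree `≥ q` over `ℚ`: no non-zero `G ∈ ℤ[X]` of degree `< q` vanishes at `b`.
(The minimal polynomial `m` of `b`, of degree `d`, divides `X^q − a^p`, so all its roots have modulus
`a^{p/q}` and `|m(0)| = a^{pd/q}` is an integer, forcing `q ∣ pd`, i.e. `q ∣ d`.) -/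
theorem kummer_aeval_ne_zero {a p q : ℕ} (ha : a.Prime) (hq : 0 < q)
    (hpq : Nat.Coprime p q) {b : ℂ} (hb : b ^ q = (a : ℂ) ^ p) {G : ℤ[X]} (hG : G ≠ 0)
    (hdeg : G.natDegree < q) : aeval b G ≠ 0 := by
  intro hGb
  have hq0 : q ≠ 0 := hq.ne'
  have ha0 : (0 : ℝ) < a := by exact_mod_cast ha.pos
  -- `b` is an algebraic integer
  have hf : aeval b (X ^ q - C ((a : ℤ) ^ p) : ℤ[X]) = 0 := by
    simp [hb]
  have hint : IsIntegral ℤ b := ⟨X ^ q - C ((a : ℤ) ^ p), monic_X_pow_sub_C _ hq0, by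
    rwa [aeval_def] at hf⟩
  have hintQ : IsIntegral ℚ b := hint.tower_top
  set m : ℤ[X] := minpoly ℤ b with hm
  have hmmonic : m.Monic := minpoly.monic hint
  have hmQ : minpoly ℚ b = m.map (algebraMap ℤ ℚ) :=
    minpoly.isIntegrallyClosed_eq_field_fractions' ℚ hint
  set d : ℕ := m.natDegree with hd
  have hdQ : (minpoly ℚ b).natDegree = d := by
    rw [hmQ, natDegree_map_eq_of_injective (algebraMap ℤ ℚ).injective_int]
  have hdpos : 0 < d := by rw [← hdQ]; exact minpoly.natDegree_pos hintQ
  -- (1) `d ≤ deg G < q`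
  have hdle : d < q := by
    have hGQ : aeval b (G.map (algebraMap ℤ ℚ)) = 0 := by rwa [aeval_map_algebraMap]
    have hGQ0 : G.map (algebraMap ℤ ℚ) ≠ 0 :=
      (Polynomial.map_ne_zero_iff (algebraMap ℤ ℚ).injective_int).mpr hG
    have h1 := natDegree_le_of_dvd (minpoly.dvd ℚ b hGQ) hGQ0
    rw [hdQ, natDegree_map_eq_of_injective (algebraMap ℤ ℚ).injective_int] at h1
    omega
  -- (2) `q ∣ d`
  have hmdvd : m ∣ X ^ q - C ((a : ℤ) ^ p) := minpoly.isIntegrallyClosed_dvd hint hf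
  set mC : ℂ[X] := m.map (Int.castRingHom ℂ) with hmC
  have hmCmonic : mC.Monic := hmmonic.map _
  have hmCdeg : mC.natDegree = d := natDegree_map_eq_of_injective (Int.castRingHom ℂ).injective_int m
  have hsplit : mC.Splits := IsAlgClosed.splits mC
  have hcard : Multiset.card mC.roots = d := by rw [← hmCdeg]; exact splits_iff_card_roots.mp hsplit
  -- every complex root of `m` has modulus `γ = (a^p)^{1/q}`
  set γ : ℝ := ((a : ℝ) ^ p) ^ ((q : ℝ)⁻¹) with hγ
  have hγ0 : 0 ≤ γ := Real.rpow_nonneg (by positivity) _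
  have hroot : ∀ β ∈ mC.roots, ‖β‖ = γ := by
    intro β hβ
    have hβm : aeval β m = 0 := by
      have := (mem_roots hmCmonic.ne_zero).mp hβ
      rwa [IsRoot.def, hmC, eval_map, ← algebraMap_int_eq, ← aeval_def] at this
    have hβf : aeval β (X ^ q - C ((a : ℤ) ^ p) : ℤ[X]) = 0 := by
      obtain ⟨u, hu⟩ := hmdvd
      rw [hu, map_mul, hβm, zero_mul]
    have hβq : β ^ q = (a : ℂ) ^ p := by
      have : β ^ q - (a : ℂ) ^ p = 0 := by simpa using hβf
      exact sub_eq_zero.mp this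
    have hn : ‖β‖ ^ q = (a : ℝ) ^ p := by
      have := congrArg norm hβq
      rwa [norm_pow, norm_pow, Complex.norm_natCast] at this
    rw [hγ, ← hn, Real.pow_rpow_inv_natCast (norm_nonneg _) hq0]
  -- `|m(0)| = γ^d`
  have hc0 : ‖(mC.coeff 0)‖ = γ ^ d := by
    rw [hsplit.coeff_zero_eq_prod_roots_of_monic hmCmonic, norm_mul, norm_pow, norm_neg, norm_one,
      one_pow, one_mul, norm_multiset_prod_eq_pow _ hroot, hcard]
  have hc0' : ‖(mC.coeff 0)‖ = ((m.coeff 0).natAbs : ℝ) := by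
    rw [hmC, coeff_map, eq_intCast, Complex.norm_intCast, Nat.cast_natAbs, Int.cast_abs]
  set n : ℕ := (m.coeff 0).natAbs with hn
  have hnγ : (n : ℝ) = γ ^ d := by rw [← hc0', hc0]
  -- `n^q = a^{pd}`
  have hnq : n ^ q = a ^ (p * d) := by
    have h1 : ((n : ℝ)) ^ q = (a : ℝ) ^ (p * d) := by
      rw [hnγ, ← pow_mul, mul_comm, pow_mul, hγ, Real.rpow_inv_natCast_pow (by positivity) hq0,
        ← pow_mul]
    exact_mod_cast h1
  -- `n = a^j`, `jq = pd`, `q ∣ d`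
  have hndvd : n ∣ a ^ (p * d) := by rw [← hnq]; exact dvd_pow_self n hq0
  obtain ⟨j, _, hj⟩ := (Nat.dvd_prime_pow ha).mp hndvd
  have hjq : j * q = p * d := by
    have h1 : a ^ (j * q) = a ^ (p * d) := by rw [pow_mul, ← hj, hnq]
    exact Nat.pow_right_injective ha.two_le h1
  have hqd : q ∣ d := by
    have h1 : q ∣ p * d := ⟨j, by rw [← hjq, mul_comm]⟩
    exact (Nat.Coprime.symm hpq).dvd_of_dvd_mul_left h1
  have := Nat.le_of_dvd hdpos hqd
  omega

section LogTwo

open Literature.NumberTheory.Transcendental in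
/-- the (crude, polynomial) approximation exponent `φ(d, L)` for `log 2` -/
def kphi (d L : ℕ) : ℝ :=
  211 * (Real.log L + 4 * d + 13) * (2 * d + 10) * (4 * (d : ℝ) ^ 2 + 7 * d + 1)

open Literature.NumberTheory.Transcendental in
/-- §22b–f. The log 2 measures (mod NW 1996 Thm 1): auxiliary statement `kphi_nonneg` (lens 6 gen 10 node, ported verbatim). -/
theorem kphi_nonneg (d L : ℕ) : 0 ≤ kphi d L := by
  unfold kphi
  have : 0 ≤ Real.log L := Real.log_natCast_nonneg L
  positivity

open Literature.NumberTheory.Transcendental in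
/-- §22b–f. The log 2 measures (mod NW 1996 Thm 1): auxiliary statement `kphi_mono` (lens 6 gen 10 node, ported verbatim). -/
theorem kphi_mono {n d : ℕ} (L : ℕ) (h : n ≤ d) : kphi n L ≤ kphi d L := by
  unfold kphi
  have hL : 0 ≤ Real.log L := Real.log_natCast_nonneg L
  have h' : (n : ℝ) ≤ d := by exact_mod_cast h
  have hn0 : (0 : ℝ) ≤ n := Nat.cast_nonneg n
  gcongr

open Literature.NumberTheory.Transcendental in
/-- §22b–f. The log 2 measures (mod NW 1996 Thm 1): auxiliary statement `two_e_log_two_le_four` (lens 6 gen 10 node, ported verbatim). -/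
theorem two_e_log_two_le_four : 2 * Real.exp 1 * Real.log 2 ≤ 4 := by
  have h1 := Real.exp_one_lt_d9
  have h2 := Real.log_two_lt_d9
  have h3 : 0 < Real.log 2 := Real.log_pos (by norm_num)
  nlinarith

open Literature.NumberTheory.Transcendental in
/-- §22b–f. The log 2 measures (mod NW 1996 Thm 1): auxiliary statement `norm_log_two` (lens 6 gen 10 node, ported verbatim). -/
theorem norm_log_two : ‖((Real.log 2 : ℝ) : ℂ)‖ = Real.log 2 := by
  rw [Complex.norm_real, Real.norm_eq_abs, abs_of_pos (Real.log_pos (by norm_num))]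

open Literature.NumberTheory.Transcendental in
/-- **Approximation measure for `log 2` (mod NW 1996 Thm 1).** -/
theorem log2_approx (hNW : NesterenkoWaldschmidt1996_thm_1) (Q : ℤ[X]) (ξ : ℂ) (L : ℕ) (hQ : Irreducible Q)
    (hn : 0 < Q.natDegree) (hξ : aeval ξ Q = 0)
    (hlen : (∑ k ∈ Finset.range (Q.natDegree + 1), |Q.coeff k|) ≤ (L : ℤ)) (hL : 3 ≤ L) :
    Real.exp (-(Q.natDegree * kphi Q.natDegree L)) ≤ ‖((Real.log 2 : ℝ) : ℂ) - ξ‖ := by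
  have hlog2 : 0 < Real.log 2 := Real.log_pos (by norm_num)
  have hlog2' : Real.log 2 < 1 := by linarith [Real.log_two_lt_d9]
  set d : ℕ := Q.natDegree with hd
  have hd1 : (1 : ℝ) ≤ d := by exact_mod_cast hn
  have hL3 : (3 : ℝ) ≤ L := by exact_mod_cast hL
  have hlogL : 0 ≤ Real.log L := Real.log_natCast_nonneg L
  -- the exponent is large: `d φ ≥ 1`
  have hbig : 1 ≤ (d : ℝ) * kphi d L := by
    unfold kphi
    have h1 : (1 : ℝ) ≤ 211 * (Real.log L + 4 * d + 13) := by nlinarith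
    have h2 : (1 : ℝ) ≤ 2 * (d : ℝ) + 10 := by linarith
    have h3 : (1 : ℝ) ≤ 4 * (d : ℝ) ^ 2 + 7 * d + 1 := by nlinarith
    calc (1 : ℝ) = 1 * (1 * 1 * 1) := by ring
      _ ≤ d * (211 * (Real.log L + 4 * d + 13) * (2 * d + 10) * (4 * (d : ℝ) ^ 2 + 7 * d + 1)) := by
          gcongr
  by_cases hξ0 : ξ = 0
  · rw [hξ0, sub_zero, norm_log_two]
    calc Real.exp (-(d * kphi d L)) ≤ Real.exp (-1) := Real.exp_le_exp.mpr (by linarith)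
      _ ≤ Real.log 2 := by
          have := Real.exp_neg_one_lt_d9; have := Real.log_two_gt_d9; linarith
  -- Theorem 1 at `θ = log 2`, `α = 2`, `β = ξ`, `A = e²`, `B = L`, `E = e`
  have h2root : aeval (2 : ℂ) (X - C (2 : ℤ) : ℤ[X]) = 0 := by
    rw [map_sub, aeval_X, aeval_C]; simp
  have hX0 : (X - C (2 : ℤ) : ℤ[X]) ≠ 0 := X_sub_C_ne_zero 2
  obtain ⟨hαalg, hβalg, hD1, hDle, hhα, hhβ⟩ := pair_bounds Q hQ hn hξ (X - C (2 : ℤ)) hX0 h2root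
  set D : ℕ := Module.finrank ℚ (IntermediateField.adjoin ℚ ({(2 : ℂ), ξ} : Set ℂ)) with hDdef
  rw [natDegree_X_sub_C, one_mul] at hDle
  have hM2 : ((X - C (2 : ℤ) : ℤ[X]).map (Int.castRingHom ℂ)).mahlerMeasure = 2 := by
    rw [Polynomial.map_sub, map_X, map_C, eq_intCast, Int.cast_ofNat, mahlerMeasure_X_sub_C]
    norm_num
  rw [hM2] at hhα
  have hMQ1 : 1 ≤ (Q.map (Int.castRingHom ℂ)).mahlerMeasure :=
    one_le_mahlerMeasure_map_of_ne_zero hQ.ne_zero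
  have hMQL : (Q.map (Int.castRingHom ℂ)).mahlerMeasure ≤ L := by
    refine (NesterenkoWaldschmidt1996.mahlerMeasure_le_length Q).trans ?_
    exact_mod_cast hlen
  have hhβ' : weilHeight₁ (IntermediateField.adjoin ℚ ({(2 : ℂ), ξ} : Set ℂ)) (fun _ : Unit => ξ) ≤
      Real.log L := hhβ.trans (Real.log_le_log (by linarith) hMQL)
  have hθ0 : (((Real.log 2 : ℝ) : ℂ)) ≠ 0 := ofReal_ne_zero.mpr hlog2.ne'
  have hA : max (weilHeight₁ (IntermediateField.adjoin ℚ ({(2 : ℂ), ξ} : Set ℂ))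
      (fun _ : Unit => (2 : ℂ))) (1 / (D : ℝ)) ≤ Real.log (Real.exp 2) := by
    rw [Real.log_exp]
    refine max_le (hhα.trans (by linarith)) ?_
    rw [div_le_iff₀ (by exact_mod_cast hD1)]
    have : (1 : ℝ) ≤ D := by exact_mod_cast hD1
    linarith
  have hmain := hNW (((Real.log 2 : ℝ) : ℂ)) 2 ξ (Real.exp 2) L (Real.exp 1) hθ0 two_ne_zero hξ0
    hαalg hβalg (Real.exp_pos 2) (by linarith) le_rfl hA (by exact_mod_cast hhβ')
  -- simplify the value side
  have hexp : cexp (((Real.log 2 : ℝ) : ℂ)) = 2 := by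
    rw [← Complex.ofReal_exp, Real.exp_log (by norm_num : (0 : ℝ) < 2)]; norm_num
  rw [hexp, sub_self, norm_zero, zero_add, ← hDdef] at hmain
  refine le_trans (Real.exp_le_exp.mpr ?_) hmain
  rw [neg_le_neg_iff, Real.log_exp, Real.log_exp, norm_log_two, max_eq_left hlog2'.le, mul_one,
    Real.log_exp, one_pow, div_one]
  -- the three factors
  have hDr1 : (1 : ℝ) ≤ D := by exact_mod_cast hD1
  have hDd : (D : ℝ) ≤ d := by exact_mod_cast hDle
  have hlogD : Real.log D ≤ d := by
    have := Real.log_le_sub_one_of_pos (by linarith : (0 : ℝ) < D); linarith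
  have hlogD0 : 0 ≤ Real.log D := Real.log_nonneg hDr1
  have hlogD2 : Real.log ((D : ℝ) + 2) ≤ d + 1 := by
    have := Real.log_le_sub_one_of_pos (by linarith : (0 : ℝ) < D + 2); linarith
  have hlogD20 : 0 ≤ Real.log ((D : ℝ) + 2) := Real.log_nonneg (by linarith)
  have hl2 : Real.log 2 ≤ 1 := hlog2'.le
  have f1 : Real.log L + Real.log 2 + 4 * Real.log D + 2 * 1 + 10 ≤ Real.log L + 4 * d + 13 := by
    linarith
  have f1pos : 0 ≤ Real.log L + Real.log 2 + 4 * Real.log D + 2 * 1 + 10 := by positivity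
  have f2 : (D : ℝ) * 2 + 2 * Real.exp 1 * Real.log 2 + 6 * 1 ≤ 2 * d + 10 := by
    linarith [two_e_log_two_le_four]
  have f2pos : 0 ≤ (D : ℝ) * 2 + 2 * Real.exp 1 * Real.log 2 + 6 * 1 := by positivity
  have f3 : 33 / 10 * (D : ℝ) * Real.log ((D : ℝ) + 2) + 1 ≤ 4 * (d : ℝ) ^ 2 + 7 * d + 1 := by
    have := mul_le_mul hDd hlogD2 hlogD20 (by linarith)
    nlinarith
  have f3pos : 0 ≤ 33 / 10 * (D : ℝ) * Real.log ((D : ℝ) + 2) + 1 := by positivity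
  unfold kphi
  calc 211 * (D : ℝ) * (Real.log L + Real.log 2 + 4 * Real.log D + 2 * 1 + 10) *
        ((D : ℝ) * 2 + 2 * Real.exp 1 * Real.log 2 + 6 * 1) *
        (33 / 10 * (D : ℝ) * Real.log ((D : ℝ) + 2) + 1)
      ≤ 211 * (d : ℝ) * (Real.log L + 4 * d + 13) * (2 * d + 10) * (4 * (d : ℝ) ^ 2 + 7 * d + 1) := by
        gcongr
    _ = d * (211 * (Real.log L + 4 * d + 13) * (2 * d + 10) * (4 * (d : ℝ) ^ 2 + 7 * d + 1)) := by
        ring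

open Literature.NumberTheory.Transcendental in
/-- **Transcendence measure for `log 2` (mod NW 1996 Thm 1)**, via Fel'dman's transference (tree). -/
theorem log2_measure (hNW : NesterenkoWaldschmidt1996_thm_1) (S : ℤ[X]) (hS : S ≠ 0) {d : ℕ} (hd : 1 ≤ d)
    (hdeg : S.natDegree ≤ d) {L : ℕ} (hlen : len S ≤ (L : ℤ)) (hL : 3 ≤ L) :
    Real.exp (-(d * (kphi d (2 ^ d * L) + Real.log (2 * d * L)))) ≤
      ‖aeval (((Real.log 2 : ℝ) : ℂ)) S‖ := by
  have h := Literature.NumberTheory.Transcendental.NesterenkoWaldschmidt1996.transcendenceMeasure_of_approximationMeasure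
    (((Real.log 2 : ℝ) : ℂ)) kphi kphi_nonneg (fun n d L h => kphi_mono L h)
    (fun Q ξ L hQ hn hξ hlen hL => log2_approx hNW Q ξ L hQ hn hξ hlen hL) S hS d L hd hdeg hlen hL
  exact_mod_cast h

open Literature.NumberTheory.Transcendental in
/-- the same with a real majorant `Λ ≥ len S + 3` and the crude exponent used in the endgame -/
theorem log2_measure' (hNW : NesterenkoWaldschmidt1996_thm_1) (S : ℤ[X]) (hS : S ≠ 0) {d : ℕ} (hd : 1 ≤ d)
    (hdeg : S.natDegree ≤ d) {Λ : ℝ} (hΛ : (len S : ℝ) + 3 ≤ Λ) :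
    Real.exp (-(d * (211 * (Real.log Λ + 5 * d + 13) * (2 * d + 10) * (4 * (d : ℝ) ^ 2 + 7 * d + 1) +
      (Real.log Λ + d + 1)))) ≤ ‖aeval (((Real.log 2 : ℝ) : ℂ)) S‖ := by
  set L : ℕ := (len S).toNat + 3 with hL
  have hlen0 : 0 ≤ len S := len_nonneg S
  have hLlen : len S ≤ (L : ℤ) := by
    rw [hL]; push_cast; rw [Int.toNat_of_nonneg hlen0]; linarith
  have hL3 : 3 ≤ L := by omega
  have h := log2_measure hNW S hS hd hdeg hLlen hL3
  refine le_trans (Real.exp_le_exp.mpr ?_) h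
  have hLΛ : (L : ℝ) ≤ Λ := by
    have : (L : ℝ) = (len S : ℝ) + 3 := by
      rw [hL]; push_cast; rw [show (((len S).toNat : ℕ) : ℝ) = ((len S : ℤ) : ℝ) from by
        exact_mod_cast Int.toNat_of_nonneg hlen0]
    linarith
  have hL0 : (0 : ℝ) < L := by exact_mod_cast (show 0 < L by omega)
  have hΛ0 : 0 < Λ := hL0.trans_le hLΛ
  have hlog : Real.log L ≤ Real.log Λ := Real.log_le_log hL0 hLΛ
  have hlogL0 : 0 ≤ Real.log (L : ℝ) := Real.log_natCast_nonneg L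
  have hd1 : (1 : ℝ) ≤ d := by exact_mod_cast hd
  have hd0 : (0 : ℝ) < d := by linarith
  have hlogd : Real.log d ≤ d := (Real.log_le_sub_one_of_pos hd0).trans (by linarith)
  have hl2 : Real.log 2 ≤ 1 := by linarith [Real.log_two_lt_d9]
  have e1 : Real.log ((2 : ℝ) ^ d * L) = d * Real.log 2 + Real.log L := by
    rw [Real.log_mul (by positivity) hL0.ne', Real.log_pow]
  have e2 : Real.log (2 * (d : ℝ) * L) = Real.log 2 + Real.log d + Real.log L := by
    rw [Real.log_mul (by positivity) hL0.ne', Real.log_mul (by norm_num) hd0.ne']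
  rw [neg_le_neg_iff]
  have hk : kphi d (2 ^ d * L) ≤
      211 * (Real.log Λ + 5 * d + 13) * (2 * d + 10) * (4 * (d : ℝ) ^ 2 + 7 * d + 1) := by
    unfold kphi
    push_cast
    rw [e1]
    have : (d : ℝ) * Real.log 2 + Real.log L + 4 * d + 13 ≤ Real.log Λ + 5 * d + 13 := by
      have := mul_le_mul_of_nonneg_left hl2 hd0.le; linarith
    have hpos : 0 ≤ (d : ℝ) * Real.log 2 + Real.log L + 4 * d + 13 := by positivity
    gcongr
  have hl : Real.log (2 * (d : ℝ) * L) ≤ Real.log Λ + d + 1 := by rw [e2]; linarith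
  have := add_le_add hk hl
  exact mul_le_mul_of_nonneg_left this hd0.le

end LogTwo

end HyperCell

end Summit.Schanuel.Schanuel.Theorems.RootDecomp1KHyper
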